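import Summits.Ventures.Crystal3D.Theorems.StickyWulffConstantCoaxialWallLawTripleVacancyGram
import HarnessLib

/-!
# Three vacancies in the fcc kissing shell, part 4: the triple-vacancy lemma (cubic frame)

HONEST FRAMING. Part of the venture `Summits/Ventures/Crystal3D` (cell `crystal3d-full`), helper
`--supports` the crux `CoaxialWallLaw` (stmt-Ventures-19481, `route-Ventures-StickyWulffConstant`),
REGISTERED line `WallLedgerF` (planner cf-p1 gen 16), stub `stub_coaxialTwoSlabAdhesion`
(terrace/riser slot ledger, absorption of foreign contacts), `k = 3` atom (part 4), assembled from part 1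
(`…TripleVacancyCore`: Gram-coordinate cores), part 2 (`…TripleVacancyShell`: kernel-decided
shell facts and the blocking pattern) and part 3 (`…TripleVacancyGram`: per-direction glue).  Cubic frame of `D₃` as in `…SingleVacancy` /
`…DoubleVacancy`.

**Theorem (`cubicShell_triple_vacancy`).**  Let `v₁, v₂, v₃` be three distinct slots and
`x, y, z` three directions of norm² `2`, pairwise compatible (`⟨·,·⟩ ≤ 1`), each compatible with
every slot other than `v₁, v₂, v₃`, and none of them equal to a slot.  Then `v₁, v₂, v₃` is a
TRIANGULAR FACE of the cuboctahedron (`⟨vᵢ, vⱼ⟩ = 1`) and each of `x, y, z` is one of the three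
TWIN POSITIONS `(2/3)(v₁ + v₂ + v₃) − vⱼ` over that face.

Ledger reading: a lattice ball with exactly three vacant slots is SATURATED (three foreign
contacts, twelve in all) only when the vacancies form a triangular face and the three foreign
balls sit in twin registry over it; in every other three-vacancy pattern it keeps `12 − deg ≥ 1`.
With L3′ (`rung_offLatticeMoved`: at most three foreign contacts from one rigid grain) this is the
last spherical atom of the crude absorption inequality `4·(12 − deg) ≥ #vacant in-plane slots`
for the rigid rung of the stub (the face-twin pattern is then excluded for twin pairs by the
lattice, and for translation pairs by the axis rule).
WHAT THIS IS NOT: the lattice (`Λ₀` / moved) form, the twin-lattice exclusion, the stub; rung F-C1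
not moved.
-/

noncomputable section

namespace Summit.Ventures.Crystal3D.Theorems

/-- **Triple-vacancy lemma (cubic frame).**  See the module docstring. -/
theorem cubicShell_triple_vacancy (a b c a' b' c' a'' b'' c'' : ℝ)
    (hn : a ^ 2 + b ^ 2 + c ^ 2 = 2) (hn' : a' ^ 2 + b' ^ 2 + c' ^ 2 = 2)
    (hn'' : a'' ^ 2 + b'' ^ 2 + c'' ^ 2 = 2)
    (v₁ v₂ v₃ : ℤ × ℤ × ℤ) (hv₁ : v₁ ∈ ([((1 : ℤ), (1 : ℤ), (0 : ℤ)), (1, -1, 0), (-1, 1, 0), (-1, -1, 0), (1, 0, 1), (1, 0, -1),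
        (-1, 0, 1), (-1, 0, -1), (0, 1, 1), (0, 1, -1), (0, -1, 1), (0, -1, -1)] : List (ℤ × ℤ × ℤ))) (hv₂ : v₂ ∈ ([((1 : ℤ), (1 : ℤ), (0 : ℤ)), (1, -1, 0), (-1, 1, 0), (-1, -1, 0), (1, 0, 1), (1, 0, -1),
        (-1, 0, 1), (-1, 0, -1), (0, 1, 1), (0, 1, -1), (0, -1, 1), (0, -1, -1)] : List (ℤ × ℤ × ℤ))) (hv₃ : v₃ ∈ ([((1 : ℤ), (1 : ℤ), (0 : ℤ)), (1, -1, 0), (-1, 1, 0), (-1, -1, 0), (1, 0, 1), (1, 0, -1),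
        (-1, 0, 1), (-1, 0, -1), (0, 1, 1), (0, 1, -1), (0, -1, 1), (0, -1, -1)] : List (ℤ × ℤ × ℤ)))
    (h12 : v₁ ≠ v₂) (h13 : v₁ ≠ v₃) (h23 : v₂ ≠ v₃)
    (h : ∀ s ∈ ([((1 : ℤ), (1 : ℤ), (0 : ℤ)), (1, -1, 0), (-1, 1, 0), (-1, -1, 0), (1, 0, 1), (1, 0, -1),
        (-1, 0, 1), (-1, 0, -1), (0, 1, 1), (0, 1, -1), (0, -1, 1), (0, -1, -1)] : List (ℤ × ℤ × ℤ)), s ≠ v₁ → s ≠ v₂ → s ≠ v₃ →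
      a * (s.1 : ℝ) + b * (s.2.1 : ℝ) + c * (s.2.2 : ℝ) ≤ 1)
    (h' : ∀ s ∈ ([((1 : ℤ), (1 : ℤ), (0 : ℤ)), (1, -1, 0), (-1, 1, 0), (-1, -1, 0), (1, 0, 1), (1, 0, -1),
        (-1, 0, 1), (-1, 0, -1), (0, 1, 1), (0, 1, -1), (0, -1, 1), (0, -1, -1)] : List (ℤ × ℤ × ℤ)), s ≠ v₁ → s ≠ v₂ → s ≠ v₃ →
      a' * (s.1 : ℝ) + b' * (s.2.1 : ℝ) + c' * (s.2.2 : ℝ) ≤ 1)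
    (h'' : ∀ s ∈ ([((1 : ℤ), (1 : ℤ), (0 : ℤ)), (1, -1, 0), (-1, 1, 0), (-1, -1, 0), (1, 0, 1), (1, 0, -1),
        (-1, 0, 1), (-1, 0, -1), (0, 1, 1), (0, 1, -1), (0, -1, 1), (0, -1, -1)] : List (ℤ × ℤ × ℤ)), s ≠ v₁ → s ≠ v₂ → s ≠ v₃ →
      a'' * (s.1 : ℝ) + b'' * (s.2.1 : ℝ) + c'' * (s.2.2 : ℝ) ≤ 1)
    (hx : ∀ s ∈ ([((1 : ℤ), (1 : ℤ), (0 : ℤ)), (1, -1, 0), (-1, 1, 0), (-1, -1, 0), (1, 0, 1), (1, 0, -1),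
        (-1, 0, 1), (-1, 0, -1), (0, 1, 1), (0, 1, -1), (0, -1, 1), (0, -1, -1)] : List (ℤ × ℤ × ℤ)), ¬ (a = (s.1 : ℝ) ∧ b = (s.2.1 : ℝ) ∧ c = (s.2.2 : ℝ)))
    (hy : ∀ s ∈ ([((1 : ℤ), (1 : ℤ), (0 : ℤ)), (1, -1, 0), (-1, 1, 0), (-1, -1, 0), (1, 0, 1), (1, 0, -1),
        (-1, 0, 1), (-1, 0, -1), (0, 1, 1), (0, 1, -1), (0, -1, 1), (0, -1, -1)] : List (ℤ × ℤ × ℤ)), ¬ (a' = (s.1 : ℝ) ∧ b' = (s.2.1 : ℝ) ∧ c' = (s.2.2 : ℝ)))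
    (hz : ∀ s ∈ ([((1 : ℤ), (1 : ℤ), (0 : ℤ)), (1, -1, 0), (-1, 1, 0), (-1, -1, 0), (1, 0, 1), (1, 0, -1),
        (-1, 0, 1), (-1, 0, -1), (0, 1, 1), (0, 1, -1), (0, -1, 1), (0, -1, -1)] : List (ℤ × ℤ × ℤ)), ¬ (a'' = (s.1 : ℝ) ∧ b'' = (s.2.1 : ℝ) ∧ c'' = (s.2.2 : ℝ)))
    (hxy : a * a' + b * b' + c * c' ≤ 1) (hxz : a * a'' + b * b'' + c * c'' ≤ 1)
    (hyz : a' * a'' + b' * b'' + c' * c'' ≤ 1) :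
    (v₁.1 * v₂.1 + v₁.2.1 * v₂.2.1 + v₁.2.2 * v₂.2.2 = 1 ∧
      v₁.1 * v₃.1 + v₁.2.1 * v₃.2.1 + v₁.2.2 * v₃.2.2 = 1 ∧
      v₂.1 * v₃.1 + v₂.2.1 * v₃.2.1 + v₂.2.2 * v₃.2.2 = 1) ∧
    ((a = 2 / 3 * ((v₁.1 : ℝ) + v₂.1 + v₃.1) - v₁.1 ∧
        b = 2 / 3 * ((v₁.2.1 : ℝ) + v₂.2.1 + v₃.2.1) - v₁.2.1 ∧
        c = 2 / 3 * ((v₁.2.2 : ℝ) + v₂.2.2 + v₃.2.2) - v₁.2.2) ∨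
      (a = 2 / 3 * ((v₁.1 : ℝ) + v₂.1 + v₃.1) - v₂.1 ∧
        b = 2 / 3 * ((v₁.2.1 : ℝ) + v₂.2.1 + v₃.2.1) - v₂.2.1 ∧
        c = 2 / 3 * ((v₁.2.2 : ℝ) + v₂.2.2 + v₃.2.2) - v₂.2.2) ∨
      (a = 2 / 3 * ((v₁.1 : ℝ) + v₂.1 + v₃.1) - v₃.1 ∧
        b = 2 / 3 * ((v₁.2.1 : ℝ) + v₂.2.1 + v₃.2.1) - v₃.2.1 ∧
        c = 2 / 3 * ((v₁.2.2 : ℝ) + v₂.2.2 + v₃.2.2) - v₃.2.2)) ∧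
    ((a' = 2 / 3 * ((v₁.1 : ℝ) + v₂.1 + v₃.1) - v₁.1 ∧
        b' = 2 / 3 * ((v₁.2.1 : ℝ) + v₂.2.1 + v₃.2.1) - v₁.2.1 ∧
        c' = 2 / 3 * ((v₁.2.2 : ℝ) + v₂.2.2 + v₃.2.2) - v₁.2.2) ∨
      (a' = 2 / 3 * ((v₁.1 : ℝ) + v₂.1 + v₃.1) - v₂.1 ∧
        b' = 2 / 3 * ((v₁.2.1 : ℝ) + v₂.2.1 + v₃.2.1) - v₂.2.1 ∧
        c' = 2 / 3 * ((v₁.2.2 : ℝ) + v₂.2.2 + v₃.2.2) - v₂.2.2) ∨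
      (a' = 2 / 3 * ((v₁.1 : ℝ) + v₂.1 + v₃.1) - v₃.1 ∧
        b' = 2 / 3 * ((v₁.2.1 : ℝ) + v₂.2.1 + v₃.2.1) - v₃.2.1 ∧
        c' = 2 / 3 * ((v₁.2.2 : ℝ) + v₂.2.2 + v₃.2.2) - v₃.2.2)) ∧
    ((a'' = 2 / 3 * ((v₁.1 : ℝ) + v₂.1 + v₃.1) - v₁.1 ∧
        b'' = 2 / 3 * ((v₁.2.1 : ℝ) + v₂.2.1 + v₃.2.1) - v₁.2.1 ∧
        c'' = 2 / 3 * ((v₁.2.2 : ℝ) + v₂.2.2 + v₃.2.2) - v₁.2.2) ∨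
      (a'' = 2 / 3 * ((v₁.1 : ℝ) + v₂.1 + v₃.1) - v₂.1 ∧
        b'' = 2 / 3 * ((v₁.2.1 : ℝ) + v₂.2.1 + v₃.2.1) - v₂.2.1 ∧
        c'' = 2 / 3 * ((v₁.2.2 : ℝ) + v₂.2.2 + v₃.2.2) - v₂.2.2) ∨
      (a'' = 2 / 3 * ((v₁.1 : ℝ) + v₂.1 + v₃.1) - v₃.1 ∧
        b'' = 2 / 3 * ((v₁.2.1 : ℝ) + v₂.2.1 + v₃.2.1) - v₃.2.1 ∧
        c'' = 2 / 3 * ((v₁.2.2 : ℝ) + v₂.2.2 + v₃.2.2) - v₃.2.2)) := by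
  -- permuted compatibility / symmetry of the pairwise hypotheses
  have p132 : ∀ {α β γ : ℝ}, (∀ s ∈ ([((1 : ℤ), (1 : ℤ), (0 : ℤ)), (1, -1, 0), (-1, 1, 0), (-1, -1, 0), (1, 0, 1), (1, 0, -1),
        (-1, 0, 1), (-1, 0, -1), (0, 1, 1), (0, 1, -1), (0, -1, 1), (0, -1, -1)] : List (ℤ × ℤ × ℤ)), s ≠ v₁ → s ≠ v₂ → s ≠ v₃ →
      α * (s.1 : ℝ) + β * (s.2.1 : ℝ) + γ * (s.2.2 : ℝ) ≤ 1) →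
      (∀ s ∈ ([((1 : ℤ), (1 : ℤ), (0 : ℤ)), (1, -1, 0), (-1, 1, 0), (-1, -1, 0), (1, 0, 1), (1, 0, -1),
        (-1, 0, 1), (-1, 0, -1), (0, 1, 1), (0, 1, -1), (0, -1, 1), (0, -1, -1)] : List (ℤ × ℤ × ℤ)), s ≠ v₁ → s ≠ v₃ → s ≠ v₂ →
      α * (s.1 : ℝ) + β * (s.2.1 : ℝ) + γ * (s.2.2 : ℝ) ≤ 1) :=
    fun hc s hs h1 h3 h2 => hc s hs h1 h2 h3
  have p231 : ∀ {α β γ : ℝ}, (∀ s ∈ ([((1 : ℤ), (1 : ℤ), (0 : ℤ)), (1, -1, 0), (-1, 1, 0), (-1, -1, 0), (1, 0, 1), (1, 0, -1),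
        (-1, 0, 1), (-1, 0, -1), (0, 1, 1), (0, 1, -1), (0, -1, 1), (0, -1, -1)] : List (ℤ × ℤ × ℤ)), s ≠ v₁ → s ≠ v₂ → s ≠ v₃ →
      α * (s.1 : ℝ) + β * (s.2.1 : ℝ) + γ * (s.2.2 : ℝ) ≤ 1) →
      (∀ s ∈ ([((1 : ℤ), (1 : ℤ), (0 : ℤ)), (1, -1, 0), (-1, 1, 0), (-1, -1, 0), (1, 0, 1), (1, 0, -1),
        (-1, 0, 1), (-1, 0, -1), (0, 1, 1), (0, 1, -1), (0, -1, 1), (0, -1, -1)] : List (ℤ × ℤ × ℤ)), s ≠ v₂ → s ≠ v₃ → s ≠ v₁ →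
      α * (s.1 : ℝ) + β * (s.2.1 : ℝ) + γ * (s.2.2 : ℝ) ≤ 1) :=
    fun hc s hs h2 h3 h1 => hc s hs h1 h2 h3
  -- every pair of vacant slots has inner product `≥ 0`
  have d12 := cubicShell_triple_pair_nonneg a b c a' b' c' a'' b'' c'' hn hn' hn'' v₁ v₂ v₃ hv₁ hv₂
    hv₃ h12 h13 h23 h h' h'' hx hy hxy hxz hyz
  have d13 := cubicShell_triple_pair_nonneg a b c a' b' c' a'' b'' c'' hn hn' hn'' v₁ v₃ v₂ hv₁ hv₃
    hv₂ h13 h12 h23.symm (p132 h) (p132 h') (p132 h'') hx hy hxy hxz hyz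
  have d23 := cubicShell_triple_pair_nonneg a b c a' b' c' a'' b'' c'' hn hn' hn'' v₂ v₃ v₁ hv₂ hv₃
    hv₁ h23 h12.symm h13.symm (p231 h) (p231 h') (p231 h'') hx hy hxy hxz hyz
  -- blocking pattern of each direction
  obtain ⟨bx12, bx13, bx23⟩ := cubicShell_triple_blocks a b c hn v₁ v₂ v₃ hv₁ hv₂ hv₃ h hx
  obtain ⟨by12, by13, by23⟩ := cubicShell_triple_blocks a' b' c' hn' v₁ v₂ v₃ hv₁ hv₂ hv₃ h' hy
  obtain ⟨bz12, bz13, bz23⟩ := cubicShell_triple_blocks a'' b'' c'' hn'' v₁ v₂ v₃ hv₁ hv₂ hv₃ h'' hz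
  -- Gram coordinates
  obtain ⟨P, hP⟩ : ∃ P : ℝ, P = a * (v₁.1 : ℝ) + b * (v₁.2.1 : ℝ) + c * (v₁.2.2 : ℝ) := ⟨_, rfl⟩
  obtain ⟨Q, hQ⟩ : ∃ Q : ℝ, Q = a * (v₂.1 : ℝ) + b * (v₂.2.1 : ℝ) + c * (v₂.2.2 : ℝ) := ⟨_, rfl⟩
  obtain ⟨R, hR⟩ : ∃ R : ℝ, R = a * (v₃.1 : ℝ) + b * (v₃.2.1 : ℝ) + c * (v₃.2.2 : ℝ) := ⟨_, rfl⟩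
  obtain ⟨P', hP'⟩ : ∃ P' : ℝ, P' = a' * (v₁.1 : ℝ) + b' * (v₁.2.1 : ℝ) + c' * (v₁.2.2 : ℝ) :=
    ⟨_, rfl⟩
  obtain ⟨Q', hQ'⟩ : ∃ Q' : ℝ, Q' = a' * (v₂.1 : ℝ) + b' * (v₂.2.1 : ℝ) + c' * (v₂.2.2 : ℝ) :=
    ⟨_, rfl⟩
  obtain ⟨R', hR'⟩ : ∃ R' : ℝ, R' = a' * (v₃.1 : ℝ) + b' * (v₃.2.1 : ℝ) + c' * (v₃.2.2 : ℝ) :=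
    ⟨_, rfl⟩
  obtain ⟨P'', hP''⟩ : ∃ P'' : ℝ, P'' = a'' * (v₁.1 : ℝ) + b'' * (v₁.2.1 : ℝ) + c'' * (v₁.2.2 : ℝ) :=
    ⟨_, rfl⟩
  obtain ⟨Q'', hQ''⟩ : ∃ Q'' : ℝ, Q'' = a'' * (v₂.1 : ℝ) + b'' * (v₂.2.1 : ℝ) + c'' * (v₂.2.2 : ℝ) :=
    ⟨_, rfl⟩
  obtain ⟨R'', hR''⟩ : ∃ R'' : ℝ, R'' = a'' * (v₃.1 : ℝ) + b'' * (v₃.2.1 : ℝ) + c'' * (v₃.2.2 : ℝ) :=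
    ⟨_, rfl⟩
  have bx12' : 1 < P ∨ 1 < Q := by rw [hP, hQ]; exact bx12
  have bx13' : 1 < P ∨ 1 < R := by rw [hP, hR]; exact bx13
  have bx23' : 1 < Q ∨ 1 < R := by rw [hQ, hR]; exact bx23
  have by12' : 1 < P' ∨ 1 < Q' := by rw [hP', hQ']; exact by12
  have by13' : 1 < P' ∨ 1 < R' := by rw [hP', hR']; exact by13
  have by23' : 1 < Q' ∨ 1 < R' := by rw [hQ', hR']; exact by23
  have bz12' : 1 < P'' ∨ 1 < Q'' := by rw [hP'', hQ'']; exact bz12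
  have bz13' : 1 < P'' ∨ 1 < R'' := by rw [hP'', hR'']; exact bz13
  have bz23' : 1 < Q'' ∨ 1 < R'' := by rw [hQ'', hR'']; exact bz23
  rcases cubicShell_triple_patterns v₁ hv₁ v₂ hv₂ v₃ hv₃ h12 h13 h23 d12 d13 d23 with
    ⟨f12, f13, f23⟩ | ⟨l12, l13, l23⟩ | ⟨l13, l12, l23⟩ | ⟨l23, l12, l13⟩
  · -- FACE: all three directions sit on the rim, hence at twin positions
    refine ⟨⟨f12, f13, f23⟩, ?_⟩
    obtain ⟨gx, x1, x2, x3, x4, x5, x6, x7, x8, x9⟩ :=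
      cubicShell_face_gram a b c hn v₁ v₂ v₃ hv₁ hv₂ hv₃ f12 f13 f23 h P Q R hP hQ hR
    obtain ⟨gy, y1, y2, y3, y4, y5, y6, y7, y8, y9⟩ :=
      cubicShell_face_gram a' b' c' hn' v₁ v₂ v₃ hv₁ hv₂ hv₃ f12 f13 f23 h' P' Q' R' hP' hQ' hR'
    obtain ⟨gz, z1, z2, z3, z4, z5, z6, z7, z8, z9⟩ :=
      cubicShell_face_gram a'' b'' c'' hn'' v₁ v₂ v₃ hv₁ hv₂ hv₃ f12 f13 f23 h'' P'' Q'' R''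
        hP'' hQ'' hR''
    have bxy := cubicShell_face_bilin a b c a' b' c' v₁ v₂ v₃ hv₁ hv₂ hv₃ f12 f13 f23 P Q R P' Q' R'
      hP hQ hR hP' hQ' hR'
    have bxz := cubicShell_face_bilin a b c a'' b'' c'' v₁ v₂ v₃ hv₁ hv₂ hv₃ f12 f13 f23 P Q R
      P'' Q'' R'' hP hQ hR hP'' hQ'' hR''
    have byz := cubicShell_face_bilin a' b' c' a'' b'' c'' v₁ v₂ v₃ hv₁ hv₂ hv₃ f12 f13 f23 P' Q' R'
      P'' Q'' R'' hP' hQ' hR' hP'' hQ'' hR''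
    obtain ⟨tx, ty, tz⟩ := cubicFace_triple P Q R P' Q' R' P'' Q'' R'' gx gy gz x1 x2 x3 x4 x5 x6
      x7 x8 x9 y1 y2 y3 y4 y5 y6 y7 y8 y9 z1 z2 z3 z4 z5 z6 z7 z8 z9 (by linarith) (by linarith)
      (by linarith)
    rw [hP, hQ, hR] at tx
    rw [hP', hQ', hR'] at ty
    rw [hP'', hQ'', hR''] at tz
    exact ⟨cubicShell_face_partner a b c hn v₁ v₂ v₃ hv₁ hv₂ hv₃ f12 f13 f23 h hx tx,
      cubicShell_face_partner a' b' c' hn' v₁ v₂ v₃ hv₁ hv₂ hv₃ f12 f13 f23 h' hy ty,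
      cubicShell_face_partner a'' b'' c'' hn'' v₁ v₂ v₃ hv₁ hv₂ hv₃ f12 f13 f23 h'' hz tz⟩
  · -- L with corner `v₃`
    exfalso
    obtain ⟨gx, x1, x2, x3, x4, x5⟩ :=
      cubicShell_L_gram a b c hn v₁ v₂ v₃ hv₁ hv₂ hv₃ l12 l13 l23 h P Q R hP hQ hR
    obtain ⟨gy, y1, y2, y3, y4, y5⟩ :=
      cubicShell_L_gram a' b' c' hn' v₁ v₂ v₃ hv₁ hv₂ hv₃ l12 l13 l23 h' P' Q' R' hP' hQ' hR'
    obtain ⟨gz, z1, z2, z3, z4, z5⟩ :=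
      cubicShell_L_gram a'' b'' c'' hn'' v₁ v₂ v₃ hv₁ hv₂ hv₃ l12 l13 l23 h'' P'' Q'' R''
        hP'' hQ'' hR''
    have bxy := cubicShell_L_bilin a b c a' b' c' v₁ v₂ v₃ hv₁ hv₂ hv₃ l12 l13 l23 P Q R P' Q' R'
      hP hQ hR hP' hQ' hR'
    have bxz := cubicShell_L_bilin a b c a'' b'' c'' v₁ v₂ v₃ hv₁ hv₂ hv₃ l12 l13 l23 P Q R
      P'' Q'' R'' hP hQ hR hP'' hQ'' hR''
    have byz := cubicShell_L_bilin a' b' c' a'' b'' c'' v₁ v₂ v₃ hv₁ hv₂ hv₃ l12 l13 l23 P' Q' R'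
      P'' Q'' R'' hP' hQ' hR' hP'' hQ'' hR''
    exact cubicL_triple_false P Q R P' Q' R' P'' Q'' R'' gx gy gz x1 x2 x3 x4 x5 y1 y2 y3 y4 y5
      z1 z2 z3 z4 z5 bx13' bx23' by13' by23' bz13' bz23' (by linarith) (by linarith) (by linarith)
  · -- L with corner `v₂` (roles `(v₁, v₃, v₂)`)
    exfalso
    have l32 : v₃.1 * v₂.1 + v₃.2.1 * v₂.2.1 + v₃.2.2 * v₂.2.2 = 1 := by linarith
    obtain ⟨gx, x1, x2, x3, x4, x5⟩ :=
      cubicShell_L_gram a b c hn v₁ v₃ v₂ hv₁ hv₃ hv₂ l13 l12 l32 (p132 h) P R Q hP hR hQ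
    obtain ⟨gy, y1, y2, y3, y4, y5⟩ :=
      cubicShell_L_gram a' b' c' hn' v₁ v₃ v₂ hv₁ hv₃ hv₂ l13 l12 l32 (p132 h') P' R' Q' hP' hR' hQ'
    obtain ⟨gz, z1, z2, z3, z4, z5⟩ :=
      cubicShell_L_gram a'' b'' c'' hn'' v₁ v₃ v₂ hv₁ hv₃ hv₂ l13 l12 l32 (p132 h'') P'' R'' Q''
        hP'' hR'' hQ''
    have bxy := cubicShell_L_bilin a b c a' b' c' v₁ v₃ v₂ hv₁ hv₃ hv₂ l13 l12 l32 P R Q P' R' Q'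
      hP hR hQ hP' hR' hQ'
    have bxz := cubicShell_L_bilin a b c a'' b'' c'' v₁ v₃ v₂ hv₁ hv₃ hv₂ l13 l12 l32 P R Q
      P'' R'' Q'' hP hR hQ hP'' hR'' hQ''
    have byz := cubicShell_L_bilin a' b' c' a'' b'' c'' v₁ v₃ v₂ hv₁ hv₃ hv₂ l13 l12 l32 P' R' Q'
      P'' R'' Q'' hP' hR' hQ' hP'' hR'' hQ''
    exact cubicL_triple_false P R Q P' R' Q' P'' R'' Q'' gx gy gz x1 x2 x3 x4 x5 y1 y2 y3 y4 y5
      z1 z2 z3 z4 z5 bx12' bx23'.symm by12' by23'.symm bz12' bz23'.symm (by linarith) (by linarith)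
      (by linarith)
  · -- L with corner `v₁` (roles `(v₂, v₃, v₁)`)
    exfalso
    have l21 : v₂.1 * v₁.1 + v₂.2.1 * v₁.2.1 + v₂.2.2 * v₁.2.2 = 1 := by linarith
    have l31 : v₃.1 * v₁.1 + v₃.2.1 * v₁.2.1 + v₃.2.2 * v₁.2.2 = 1 := by linarith
    obtain ⟨gx, x1, x2, x3, x4, x5⟩ :=
      cubicShell_L_gram a b c hn v₂ v₃ v₁ hv₂ hv₃ hv₁ l23 l21 l31 (p231 h) Q R P hQ hR hP
    obtain ⟨gy, y1, y2, y3, y4, y5⟩ :=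
      cubicShell_L_gram a' b' c' hn' v₂ v₃ v₁ hv₂ hv₃ hv₁ l23 l21 l31 (p231 h') Q' R' P' hQ' hR' hP'
    obtain ⟨gz, z1, z2, z3, z4, z5⟩ :=
      cubicShell_L_gram a'' b'' c'' hn'' v₂ v₃ v₁ hv₂ hv₃ hv₁ l23 l21 l31 (p231 h'') Q'' R'' P''
        hQ'' hR'' hP''
    have bxy := cubicShell_L_bilin a b c a' b' c' v₂ v₃ v₁ hv₂ hv₃ hv₁ l23 l21 l31 Q R P Q' R' P'
      hQ hR hP hQ' hR' hP'
    have bxz := cubicShell_L_bilin a b c a'' b'' c'' v₂ v₃ v₁ hv₂ hv₃ hv₁ l23 l21 l31 Q R P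
      Q'' R'' P'' hQ hR hP hQ'' hR'' hP''
    have byz := cubicShell_L_bilin a' b' c' a'' b'' c'' v₂ v₃ v₁ hv₂ hv₃ hv₁ l23 l21 l31 Q' R' P'
      Q'' R'' P'' hQ' hR' hP' hQ'' hR'' hP''
    exact cubicL_triple_false Q R P Q' R' P' Q'' R'' P'' gx gy gz x1 x2 x3 x4 x5 y1 y2 y3 y4 y5
      z1 z2 z3 z4 z5 bx12'.symm bx13'.symm by12'.symm by13'.symm bz12'.symm bz13'.symm (by linarith)
      (by linarith) (by linarith)

end Summit.Ventures.Crystal3D.Theorems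

end
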